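import Summits.HodgeConjecture.HodgeConjecture.Theorems.Ring2AbelianAllSpreadFloorEvenPrimitive
import Literature.AlgebraicGeometry.Motives.AbelianVarietyProduct
import Literature.AlgebraicGeometry.HodgeTheory.LefschetzOneOne
import Literature.AlgebraicGeometry.HodgeTheory.LefschetzOneOneHolds
import Literature.AlgebraicGeometry.HodgeTheory.PulledBackAlgebraicClasses
import HarnessLib

/-!
# Ring 2 · AbelianAll · SPREADING axis, part XVII — THE THREE ANCHORED FLOOR NODES ARE ONE STATEMENT MODULO A
# CLASSICAL PRODUCT LEMMA: `F_CM^{prim,ev} ⟹ F_CM^prim` and `F_CM^{prim,ev} ⟹ F_CM` by pulling anchored data back along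
# the slice `(𝟙, 0) : A ⟶ A × B`, modulo the displayed primitive-lift-to-a-product shape `(PL)` ALONE (Lefschetz (1,1), used for `p = 1`,
# is the tree's theorem `lefschetzOneOne_rational_holds`, supplied by name in §5; rev 2; rev 3 = header precision on what the tree
# has / lacks towards `(PL)`, statements byte-identical to rev 2)

research route, not a corollary; conditional on HC_CM plus one named minimal statement.
(Cell line: research route conditional on HC_CM; not a corollary; Q11.4-sentence-2 already refuted in dim ≥ 3.)

Seat `pub-hodge-ring2-ab-spread-1` (SPREADING), generation 27. Nothing in this file is a case of the Hodge conjecture.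
`HC_CM` = `Theses.RankFourFaces.CMAbelianHodge` does NOT occur in this file; `HC_AV` = `Theses.PadicSemiregularLift.HodgeAbelianVarieties`
does not occur either; the item `Theses.RankFourFaces.CMToAbelian` (stmt-HodgeConjecture-16267) stays OPEN. No definition, no new
named fact, no sorry, no new node. Two hypotheses are DISPLAYED and enter as binders: the shape `(PL)` below (a `local notation`,
no `def` — the discipline of parts XIII/XVI) and, in §3–§4, the registered Literature named fact `hL : HodgeTheory.lefschetzOneOne_rational`
(Lefschetz's theorem on `(1,1)`-classes, Voisin I Thm. 11.30; used only to exclude offenders with `p = 1`). REV 2 (same generation):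
`lefschetzOneOne_rational` IS DISCHARGED in the tree — `HodgeTheory.lefschetzOneOne_rational_holds` (file `HodgeTheory/LefschetzOneOneHolds`,
2026-08-16: `lefschetzOneOne_rational_of_kodairaSerre_fact` applied to `kodairaSerre_exists_globalSection_algebraicTwist_holds`, Serre's
dimension count; count once: the discharge is those files', not this axis's) — so §5 supplies the binder `hL` BY NAME and the NET modulus of
every row of this file is the displayed `(PL)` ALONE (rev 1's header wrongly called the fact "not discharged"; corrected here).

## Why this file

Parts VII, XIV, XV of this axis typed three anchored floor nodes and the fact-free edges DOWN the binder ladder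
`F_CM ⟹ F_CM^prim ⟹ F_CM^{prim,ev}` (`HodgeFailureSpreadsToCMFibre`, `PrimitiveHodgeFailureSpreadsToCMFibre`,
`EvenPrimitiveHodgeFailureSpreadsToCMFibre`; census nodes N1, N102, N103), all three EXACT complements of `HC_CM` inside `HC_AV`,
hence equivalent GIVEN `HC_CM`; the converses were recorded "open HC_CM-free" (XIV/XV headers, honest item (i): "an anchored datum for
`s_! c` on `A × B` is not one for `c` on `A`"). That caveat concerns the GYSIN image `s_! c` (needed to reach the MIDDLE degree). For the
two restrictions actually made by N102/N103 — PRIMITIVE and EVEN-DIMENSIONAL, not middle — the PULL-BACK suffices, and anchored data DO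
pull back: if `(f, s, W, A₁, e₁, g, q)` anchors `c'` on `A' = A × B` and `ι = (𝟙, 0) : A ⟶ A × B` is the slice homomorphism with
`ι^* c' = c`, then `(f, s, W, A₁, e₁, ι ≫ g, q)` anchors `c` on `A` (`IsCMAnchoredDatumFor.comap`, three lines), with the SAME CM fibre
at which `W` fails to be algebraic. What remains is a statement of classical Hodge theory on products with NO family, NO CM point and NO
algebraicity in it — the primitive lift `(PL)`: every rational `(p,p)` class `c` on `A` (`p ≥ 2`) is `ι^* c'` for a rational `(p,p)`
class `c'` on some `A × B` of EVEN dimension `≥ 2p` which is PRIMITIVE for some hard-Lefschetz datum of `A × B`.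

## The status of `(PL)` — an HYPOTHESIS here, with a print-level proof recorded in the seat file (SPREAD.md §35.3), NOT a tree theorem

`(PL)` is displayed, never asserted, and every row using it is flagged `K[PL]`. It is NOT a registered Literature fact and it is NOT
cited as a fact anywhere. Print-level argument (this seat's, recorded with an exact toy verification in SPREAD.md §35.3; to be TYPED by
whoever builds the product-polarisation API): take `B = Eᵐ` (`E` an elliptic curve, `m ≥ p`, `m ≥ 2p - dim A`, `dim A + m` even), polarise
`A × B` by the box class `h = pr_A^* h_A + pr_B^* h_B` of hyperplane classes (the Segre embedding; hard Lefschetz for `h` is the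
`𝔰𝔩₂`-equivariance of the Künneth isomorphism, André 1996 §1.3 (p. 12) citing Deligne, Weil II (1.6.12.1)); write the `h_A`-Lefschetz
decomposition `c = Σ_k L^k c_k` (`max(0, 2p - dim A) ≤ k ≤ p`, `c_k` primitive rational of type `(p-k, p-k)`, Voisin I §6.2.3); in the
`𝔰𝔩₂ ⊗ 𝔰𝔩₂`-module (string of `c_k`) ⊗ (string `1, h_B, …, h_Bᵐ`) the Clebsch–Gordan lowest-weight vector
`u_k = Σ_{a ≤ k} α_a · (L_A^a c_k) × h_B^{k-a}` (`α_{a+1}/α_a = -(k-a)(m-k+a+1)/((a+1)(m_k-a))`, `m_k = dim A - 2p + 2k ≥ k`, all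
`α_a ≠ 0`) is `h`-primitive of degree `2p`, rational, of type `(p,p)`, and `ι^* u_k = α_k · L^k c_k` (the terms with `a < k` carry a
positive power of `h_B` and die on the slice `A × {0}`); so `c' = Σ_k α_k⁻¹ u_k` does it. Exact check of the Clebsch–Gordan step
(kernel of `Λ ⊗ 1 + 1 ⊗ Λ` on `V_m ⊗ V_{m'}`, surjectivity onto the `B`-degree-0 coordinates, primitivity via `L`-powers) for all
`m, m' ≤ 6`: seat script `work/sl2_primitive_lift_check.py`, PASS. What the TREE has towards a discharge: `AbelianVariety.prod/prodLift/fst`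
with `(A.prod B).X = A.X ⊗ B.X` (`Motives/AbelianVarietyProduct`), bijective Künneth (`HodgeTheory/ComplexBettiKunneth`), exterior
products of Hodge types and of algebraic classes (`HodgeTypeExteriorProduct`, `AlgebraicClassesExteriorProduct`), the Segre embedding of
a product of embedded varieties as a closed immersion (`Motives/SegreEmbedding`: `IsProjectiveOver.tensor`,
`isClosedImmersion_tensorHom_left`) with ADDITIVE rational hyperplane class `σ^* g = fst^* g₁ + snd^* g₂`
(`Motives/SegreHyperplaneClass.exists_segreHyperplaneClasses`), hard-Lefschetz DATA for the hyperplane class of ANY projective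
embedding (`HardLefschetzNFoldHolds.exists_hardLefschetzNFold_of_pullback_eq_fubiniStudy_smul` with
`PgZeroSurfaceFamilyFiniteMonodromy.exists_fubiniStudy_eq_smul_map`, and `HyperplaneClassHardLefschetzPullback.hasHardLefschetzProperty_map_of_forall_eq_smul`),
the Lefschetz decomposition (`LefschetzDecompositionSingular`, part XIV §1). CONSEQUENTLY (rev. 3 precision; rev. 2 of this header
over-stated the gap): hard Lefschetz — bijectivity of `L^{n-k}` — for the BOX class `fst^* h_A + snd^* h_B` (`h_A`, `h_B` hyperplane
classes of projective embeddings) is OBTAINABLE in the tree by assembling the decls just named, because that class is, up to a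
non-zero scalar, the hyperplane class of the composite Segre embedding `A × B ⟶ ℙⁿ × ℙᵐ ⟶ ℙ^{nm+n+m}`; no `𝔰𝔩₂ ⊗ 𝔰𝔩₂` argument is needed
for it (the "not here" notes of `HodgeTheory/MotivatedClasses` (§1.3) and `HodgeTheory/KaehlerClass` (ii) concern André's product
polarisation formalism and Kähler-ness of external sums, which this route bypasses). What the tree genuinely LACKS for `(PL)` is the
`𝔰𝔩₂`-EQUIVARIANCE of Künneth for the box class — concretely the binomial (Leibniz) expansion of `lefschetzPowTo (fst^* h_A + snd^* h_B)`
on cross products `fst^* x ∪ snd^* y` together with `h_B^{m+1} = 0` on an `m`-fold — and the Clebsch–Gordan lowest-weight computation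
built on it (André 1996 §1.3 via [D80] 1.6.12.1). So of the two requests recorded by the seat, R1′ (a hard-Lefschetz datum on
`A.prod B` whose class is a non-zero multiple of the box class) is an ASSEMBLY of named tree theorems, and R2′ (= `(PL)`) carries all
the missing mathematics. `(PL)` stays a binder, and this file's rows credit nothing until it is proved.
(rev. 4) R1′ is DONE: part XVIII `Theorems/Ring2AbelianAllSpreadBoxLefschetz.lean` proves `exists_hardLefschetzNFold_prod_box` — on
`A.prod B` a hard-Lefschetz datum whose class is `t • (fst^* h_A + snd^* h_B)`, `t ≠ 0`, with `h_A`, `h_B` rational classes of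
hard-Lefschetz data on the factors up to non-zero scalars — so R2′ (= `(PL)`: the `𝔰𝔩₂`-equivariance of Künneth for that class and the
Clebsch–Gordan lift) ALONE remains.

## What is proved (all inside `namespace Summit.HodgeConjecture.HodgeConjecture.Ring2.AbelianAll`)

* §1 `IsCMAnchoredDatumFor.comap` — anchored data pull back along ANY homomorphism `ι : A ⟶ A'` with `ι^* c' = c` (fact-free);
  `not_mem_algebraicClasses_of_map_eq` — `c ∉ Nᵖ(A) ⟹ c' ∉ Nᵖ(A')` (fact-free; `map_mem_algebraicClasses_of_abelianVariety`).
* §2 `exists_isCMAnchoredDatumFor_of_evenPrimitive_of_primitiveLiftToProduct (hPL) (h : F_CM^{prim,ev})` — for `p ≥ 2` every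
  non-algebraic rational `(p,p)` class on every complex abelian variety has a CM-pointed anchored datum with a CM failure (K[PL]).
* §3 EDGES UP THE LADDER: `primitiveHodgeFailureSpreadsToCMFibre_of_evenPrimitive_of_primitiveLiftToProduct (hPL) : F_CM^{prim,ev} → F_CM^prim`
  (K[PL]; N103 → N102); `hodgeFailureSpreadsToCMFibre_of_evenPrimitive_of_primitiveLiftToProduct_of_lefschetzOneOne (hPL) (hL) :
  F_CM^{prim,ev} → F_CM` and `hodgeFailureSpreadsToCMFibre_of_primitive_of_primitiveLiftToProduct_of_lefschetzOneOne (hPL) (hL) :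
  F_CM^prim → F_CM` (K[PL, hL]; N103 → N1, N102 → N1; `p = 0` by the tree's `algebraicClasses_zero`, `p = 1` by `hL`, `p ≥ 2` by §2).
* §4 COLLAPSE ROWS: `primitiveHodgeFailureSpreadsToCMFibre_iff_evenPrimitive_of_primitiveLiftToProduct (hPL) : F_CM^prim ↔ F_CM^{prim,ev}`
  (K[PL]); `hodgeFailureSpreadsToCMFibre_iff_primitive_…` and `hodgeFailureSpreadsToCMFibre_iff_evenPrimitive_… (hPL) (hL) :
  F_CM ↔ F_CM^prim`, `F_CM ↔ F_CM^{prim,ev}` (K[PL, hL]) — with parts XIV/XV's fact-free downward edges as the other halves.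
* §5 (rev 2) THE `hL` BINDER SUPPLIED BY NAME (`lefschetzOneOne_rational_holds`): the rows of §3–§4 with `hL` discharged —
  `hodgeFailureSpreadsToCMFibre_of_evenPrimitive_of_primitiveLiftToProduct`,
  `hodgeFailureSpreadsToCMFibre_of_primitive_of_primitiveLiftToProduct`, `hodgeFailureSpreadsToCMFibre_iff_primitive_of_primitiveLiftToProduct`,
  `hodgeFailureSpreadsToCMFibre_iff_evenPrimitive_of_primitiveLiftToProduct` and the summary
  `spreadFloor_nodes_collapse_of_primitiveLiftToProduct (hPL) : (F_CM ↔ F_CM^prim) ∧ (F_CM^prim ↔ F_CM^{prim,ev})` — all K[PL] (N1 ≡ N102 ≡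
  N103 modulo `(PL)` alone).

## Honest column

Nothing here proves `HC_AV`, `HC_CM`, `CMToAbelian`, `F_CM`, `F_CM^prim`, `F_CM^{prim,ev}` or `(PL)`; no case of the Hodge conjecture is
proved; `HC_CM` is not even mentioned; Lefschetz (1,1) is USED (`lefschetzOneOne_rational_holds`, §5) and is no theorem of this axis. NO HC_CM-free
converse is proved OUTRIGHT: the upward edges are modulo the displayed `(PL)`, i.e. they are comparison rows that credit nothing (the file
audit classifies them `proof.conditional`). CENSUS STATUS (rev. 4; R-55, F-ab-103): `(PL)` is DISPLAY-ONLY and NOT IN THE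
CENSUS — a `local notation3`, not a node; it is never ordered against N1 / N102 / N103 nor entered as a `B_min` candidate (it is a
classical lemma of Hodge theory on products whose truth is independent of every Hodge-conjecture statement, not a spreading statement);
this pen mints no `def` for it; the census of record sees no edge from this file, and when `(PL)` is a theorem the rows below become
plain kernel rows — then, and only then, the census sees N1 ≡ N102 ≡ N103. What
the rows SHOW: the restriction of the floor to primitive classes on even-dimensional abelian varieties (N102, N103) is a change of BINDER
licensed by a classical lemma on products, not a change of strength — modulo `(PL)` the three anchored nodes are ONE statement. **B_min of record UNCHANGED**: least TYPED node `F_CM^{prim,ev}` (N103), below N102 and N1 by fact-free kernel edges whose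
converses are, IN THE TREE, exactly as open as `(PL)`; "minimal" is claimed for nothing (F-ab-4, F-ab-81, F-ab-96), and — new with this
part — "strictly smaller than `F_CM`" is claimed for nothing either. Parts VII, XIV, XV, XVI untouched.
[cite: Andre1996Motifs, §1.3 (p. 12) and Lemme 6.3.1 (p. 31)] [cite: VoisinHodgeI2002, §6.2.3 Def. 6.24 and Cor. 6.26]
[cite: VoisinHodgeI2002, Thm. 11.30, Cor. 11.34 and §11.3.3] [cite: Deligne1982HodgeCycles, Prop. 6.1]
-/

set_option linter.dupNamespace false

namespace Summit.HodgeConjecture.HodgeConjecture.Ring2.AbelianAll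

open CategoryTheory AlgebraicGeometry
open Literature.AlgebraicGeometry Literature.AlgebraicGeometry.Motives
open Literature.AlgebraicGeometry.HodgeTheory
open Literature.AlgebraicTopology.SingularHomology (singularCohomology)
open Literature.AlgebraicGeometry.Deligne1982 (cmLocus)
open Summit.HodgeConjecture.HodgeConjecture

/-- DISPLAY ONLY (no `def`, no assertion): the primitive-lift-to-a-product shape `(PL)` — for every complex abelian variety `A`,
every `p ≥ 2` and every rational `(p,p)` class `c ∈ H²ᵖ(A(ℂ); ℂ)` there are an abelian variety `B`, a hard-Lefschetz datum `Λ'` of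
`A × B` and a rational `(p,p)` class `c'` on `A × B`, `Λ'`-PRIMITIVE, with `dim (A × B)` EVEN and `≥ 2p`, pulling back to `c` along the
slice homomorphism `(𝟙, 0) : A ⟶ A × B`. A HYPOTHESIS wherever used (rows flagged K[PL]); print-level argument (box polarisation of
`A × Eᵐ`, `𝔰𝔩₂`-equivariant Künneth, Clebsch–Gordan lowest-weight vectors) in the file header and the seat file SPREAD.md §35.3; NOT a
tree theorem, NOT a registered fact. [cite: Andre1996Motifs, §1.3 (p. 12)] [cite: VoisinHodgeI2002, §6.2.3 Def. 6.24 and Cor. 6.26] -/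
local notation3 (prettyPrint := false) "PrimitiveLiftToProduct[]" =>
  ∀ (A : AbelianVariety ℂ) (p : ℕ), 2 ≤ p → ∀ (c : complexBetti A.X (2 * p)), IsRationalClass c →
    IsOfHodgeType A.dim A.X (2 * p) p p c →
      ∃ (B : AbelianVariety ℂ) (Λ' : HardLefschetzNFold (A.prod B).dim (A.prod B).X)
        (c' : complexBetti (A.prod B).X (2 * p)),
        Even (A.prod B).dim ∧ 2 * p ≤ (A.prod B).dim ∧ IsRationalClass c' ∧
          IsOfHodgeType (A.prod B).dim (A.prod B).X (2 * p) p p c' ∧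
          c' ∈ primitiveClasses Λ'.hyperplaneClass (A.prod B).dim (2 * p) ∧
          complexBetti.map (AbelianVariety.prodLift (𝟙 A) (0 : A ⟶ B)).hom.hom.hom (2 * p) c' = c

variable {𝒳 S : SchemeOver ℂ}

/-! ## §1 Anchored data pull back along homomorphisms (fact-free) -/

/-- **Anchored data pull back along homomorphisms.** If `(f, n, s, W)` with anchor `(A₁, e₁, g, q)` is a CM-pointed anchored datum
for `c'` on `A'` and `ι : A ⟶ A'` is a homomorphism with `ι^* c' = c`, then the same `(f, n, s, W)` with anchor `(A₁, e₁, ι ≫ g, q)`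
is one for `c` on `A`: `(ι ≫ g)^* e₁^* W_s = ι^*(q • c') = q • c`. NO fact (functoriality of `H^*(–(ℂ); ℂ)`). [folklore] -/
theorem IsCMAnchoredDatumFor.comap {A A' : AbelianVariety ℂ} (ι : A ⟶ A') {p : ℕ} {c : complexBetti A.X (2 * p)}
    {c' : complexBetti A'.X (2 * p)} (hι : complexBetti.map ι.hom.hom.hom (2 * p) c' = c)
    {f : 𝒳 ⟶ S} {n : ℕ} {s : ComplexPoints S} {W : complexBetti 𝒳 (2 * p)} (h : IsCMAnchoredDatumFor A' p c' f n s W) :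
    IsCMAnchoredDatumFor A p c f n s W := by
  obtain ⟨hfam, hW, A₁, e₁, g, q, hq, hgc⟩ := h
  refine ⟨hfam, hW, A₁, e₁, ι ≫ g, q, hq, ?_⟩
  have hcomp : (ι ≫ g).hom.hom.hom = ι.hom.hom.hom ≫ g.hom.hom.hom := rfl
  rw [hcomp]
  change (complexBetti.map (ι.hom.hom.hom ≫ g.hom.hom.hom) (2 * p)).hom _ = _
  rw [complexBetti.map_comp_apply]
  change (complexBetti.map ι.hom.hom.hom (2 * p)).hom (complexBetti.map g.hom.hom.hom (2 * p) _) = _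
  rw [hgc, map_smul]
  exact congrArg _ hι

/-- **Non-algebraicity lifts along a homomorphism with the given pull-back**: if `ι^* c' = c` and `c ∉ Nᵖ H²ᵖ(A)`, then
`c' ∉ Nᵖ H²ᵖ(A')` — pull-backs of algebraic classes along morphisms to abelian varieties are algebraic
(`map_mem_algebraicClasses_of_abelianVariety`, a tree theorem). NO fact. [folklore] -/
theorem not_mem_algebraicClasses_of_map_eq {A A' : AbelianVariety ℂ} (ι : A ⟶ A') {p : ℕ}
    {c : complexBetti A.X (2 * p)} {c' : complexBetti A'.X (2 * p)}
    (hι : complexBetti.map ι.hom.hom.hom (2 * p) c' = c) (hc : c ∉ algebraicClasses A.X p) :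
    c' ∉ algebraicClasses A'.X p := fun h' ↦
  hc (hι ▸ map_mem_algebraicClasses_of_abelianVariety AbelianVariety.isSmoothProjective_holds A' ι.hom.hom.hom h')

/-! ## §2 The core transport (K[PL]) -/

/-- **Every non-algebraic rational `(p,p)` class with `p ≥ 2` on every complex abelian variety has a CM-pointed anchored datum with a
CM failure — from `F_CM^{prim,ev}` and the primitive lift `(PL)`.** Lift `c` to a `Λ'`-primitive rational `(p,p)` class `c'` on an
even-dimensional `A × B` with `(𝟙,0)^* c' = c` (`hPL`); `c'` is not algebraic (§1); `F_CM^{prim,ev}` anchors `c'` with a CM failure;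
pull the anchor back along `(𝟙, 0)` (§1). Modulo the displayed `(PL)`; credits nothing. [folklore] -/
theorem exists_isCMAnchoredDatumFor_of_evenPrimitive_of_primitiveLiftToProduct (hPL : PrimitiveLiftToProduct[])
    (h : EvenPrimitiveHodgeFailureSpreadsToCMFibre) (A : AbelianVariety ℂ) {p : ℕ} (hp : 2 ≤ p)
    (c : complexBetti A.X (2 * p)) (hc : IsRationalClass c) (hpp : IsOfHodgeType A.dim A.X (2 * p) p p c)
    (hnc : c ∉ algebraicClasses A.X p) :
    ∃ (n : ℕ) (𝒳 S : SchemeOver ℂ) (f : 𝒳 ⟶ S) (s : ComplexPoints S) (W : complexBetti 𝒳 (2 * p)),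
      IsCMAnchoredDatumFor A p c f n s W ∧
        ∃ s' ∈ cmLocus f n, complexBetti.map (fiberι f s') (2 * p) W ∉ algebraicClasses (fiberOver f s') p := by
  obtain ⟨B, Λ', c', hev, hle, hc'rat, hc'pp, hc'prim, hι⟩ := hPL A p hp c hc hpp
  have hX' : IsSmoothProjective (A.prod B).dim (A.prod B).X := AbelianVariety.isSmoothProjective_holds
  have hc'nc : c' ∉ algebraicClasses (A.prod B).X p := not_mem_algebraicClasses_of_map_eq _ hι hnc
  obtain ⟨n, 𝒳, S, f, s, W, hdat, hfail⟩ := h (A.prod B) hX' hev Λ' p hp hle c' hc'rat hc'pp hc'prim hc'nc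
  exact ⟨n, 𝒳, S, f, s, W, hdat.comap _ hι, hfail⟩

/-! ## §3 Edges UP the binder ladder (K[PL], resp. K[PL, hL]; `hL` is supplied in §5) -/

/-- **`F_CM^{prim,ev} ⟹ F_CM^prim` (census N103 → N102), modulo the displayed `(PL)`**: forget that `c` is `Λ`-primitive and that
`2p ≤ dim A`, keep `p ≥ 2`, apply §2. The converse is part XV's fact-free
`evenPrimitiveHodgeFailureSpreadsToCMFibre_of_primitiveHodgeFailureSpreadsToCMFibre`. Credits nothing until `(PL)` is a theorem. [folklore] -/
theorem primitiveHodgeFailureSpreadsToCMFibre_of_evenPrimitive_of_primitiveLiftToProduct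
    (hPL : PrimitiveLiftToProduct[]) (h : EvenPrimitiveHodgeFailureSpreadsToCMFibre) :
    PrimitiveHodgeFailureSpreadsToCMFibre :=
  fun A _ _ _ hp _ c hc hpp _ hnc ↦
    exists_isCMAnchoredDatumFor_of_evenPrimitive_of_primitiveLiftToProduct hPL h A hp c hc hpp hnc

/-- **`F_CM^{prim,ev} ⟹ F_CM` (census N103 → N1), modulo `(PL)` and Lefschetz (1,1)**: an offender `c ∈ H²ᵖ(A)` has `p ≠ 0`
(`algebraicClasses_zero`: `N⁰ H⁰ = ⊤`, tree theorem) and `p ≠ 1` (`hL : lefschetzOneOne_rational`, the registered named fact —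
Lefschetz's theorem on `(1,1)`-classes, displayed as a binder in this row and supplied by name (`lefschetzOneOne_rational_holds`) in §5), so
`p ≥ 2` and §2 applies.
Credits nothing.
[cite: VoisinHodgeI2002, Thm. 11.30, Cor. 11.34 and §11.3.3] -/
theorem hodgeFailureSpreadsToCMFibre_of_evenPrimitive_of_primitiveLiftToProduct_of_lefschetzOneOne
    (hPL : PrimitiveLiftToProduct[]) (hL : lefschetzOneOne_rational) (h : EvenPrimitiveHodgeFailureSpreadsToCMFibre) :
    HodgeFailureSpreadsToCMFibre := by
  intro A hA p c hc hpp hnc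
  rcases Nat.lt_or_ge p 2 with hp | hp
  · exfalso
    interval_cases p
    · exact hnc (by rw [algebraicClasses_zero]; trivial)
    · exact hnc (hL hA c hc hpp)
  · exact exists_isCMAnchoredDatumFor_of_evenPrimitive_of_primitiveLiftToProduct hPL h A hp c hc hpp hnc

/-- **`F_CM^prim ⟹ F_CM` (census N102 → N1), modulo `(PL)` and Lefschetz (1,1)**: through part XV's fact-free
`F_CM^prim ⟹ F_CM^{prim,ev}` and the previous row. Credits nothing. [cite: VoisinHodgeI2002, Thm. 11.30, Cor. 11.34 and §11.3.3] -/
theorem hodgeFailureSpreadsToCMFibre_of_primitive_of_primitiveLiftToProduct_of_lefschetzOneOne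
    (hPL : PrimitiveLiftToProduct[]) (hL : lefschetzOneOne_rational) (h : PrimitiveHodgeFailureSpreadsToCMFibre) :
    HodgeFailureSpreadsToCMFibre :=
  hodgeFailureSpreadsToCMFibre_of_evenPrimitive_of_primitiveLiftToProduct_of_lefschetzOneOne hPL hL
    (evenPrimitiveHodgeFailureSpreadsToCMFibre_of_primitiveHodgeFailureSpreadsToCMFibre h)

/-! ## §4 Collapse rows -/

/-- **`F_CM^prim ⟺ F_CM^{prim,ev}` (N102 ≡ N103) modulo the displayed `(PL)`**: part XV's fact-free edge down, §3 up. [folklore] -/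
theorem primitiveHodgeFailureSpreadsToCMFibre_iff_evenPrimitive_of_primitiveLiftToProduct
    (hPL : PrimitiveLiftToProduct[]) :
    PrimitiveHodgeFailureSpreadsToCMFibre ↔ EvenPrimitiveHodgeFailureSpreadsToCMFibre :=
  ⟨evenPrimitiveHodgeFailureSpreadsToCMFibre_of_primitiveHodgeFailureSpreadsToCMFibre,
    primitiveHodgeFailureSpreadsToCMFibre_of_evenPrimitive_of_primitiveLiftToProduct hPL⟩

/-- **`F_CM ⟺ F_CM^prim` (N1 ≡ N102) modulo `(PL)` and Lefschetz (1,1)**: part XIV's fact-free edge down, §3 up.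
[cite: VoisinHodgeI2002, Thm. 11.30, Cor. 11.34 and §11.3.3] -/
theorem hodgeFailureSpreadsToCMFibre_iff_primitive_of_primitiveLiftToProduct_of_lefschetzOneOne
    (hPL : PrimitiveLiftToProduct[]) (hL : lefschetzOneOne_rational) :
    HodgeFailureSpreadsToCMFibre ↔ PrimitiveHodgeFailureSpreadsToCMFibre :=
  ⟨primitiveHodgeFailureSpreadsToCMFibre_of_hodgeFailureSpreadsToCMFibre,
    hodgeFailureSpreadsToCMFibre_of_primitive_of_primitiveLiftToProduct_of_lefschetzOneOne hPL hL⟩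

/-- **`F_CM ⟺ F_CM^{prim,ev}` (N1 ≡ N103) modulo `(PL)` and Lefschetz (1,1)**: part XV's fact-free edge down, §3 up. With
part XV's `HC_AV_iff_HC_CM_and_evenPrimitiveHodgeFailureSpreadsToCMFibre` this is the typed content of "the primitive / even
restriction of the floor is a change of binder, not of strength" — modulo `(PL)`; B_min of record unchanged; "minimal" claimed for
nothing. [cite: VoisinHodgeI2002, Thm. 11.30, Cor. 11.34 and §11.3.3] [cite: Andre1996Motifs, §1.3 (p. 12)] -/
theorem hodgeFailureSpreadsToCMFibre_iff_evenPrimitive_of_primitiveLiftToProduct_of_lefschetzOneOne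
    (hPL : PrimitiveLiftToProduct[]) (hL : lefschetzOneOne_rational) :
    HodgeFailureSpreadsToCMFibre ↔ EvenPrimitiveHodgeFailureSpreadsToCMFibre :=
  ⟨evenPrimitiveHodgeFailureSpreadsToCMFibre_of_hodgeFailureSpreadsToCMFibre,
    hodgeFailureSpreadsToCMFibre_of_evenPrimitive_of_primitiveLiftToProduct_of_lefschetzOneOne hPL hL⟩

/-! ## §5 (rev 2) The `hL` binder supplied by name: every row modulo `(PL)` alone

Lefschetz's theorem on `(1,1)`-classes in its rational form is DISCHARGED in the tree: `lefschetzOneOne_rational_holds` (file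
`HodgeTheory/LefschetzOneOneHolds`; count once — the discharge is that file's and its imports', this axis only applies it).
[cite: VoisinHodgeI2002, Thm. 11.30, Cor. 11.34 and §11.3.3] -/

/-- **`F_CM^{prim,ev} ⟹ F_CM` (N103 → N1) modulo the displayed `(PL)` ALONE**: §3 with `hL := lefschetzOneOne_rational_holds`.
Credits nothing until `(PL)` is a theorem. [folklore] -/
theorem hodgeFailureSpreadsToCMFibre_of_evenPrimitive_of_primitiveLiftToProduct
    (hPL : PrimitiveLiftToProduct[]) (h : EvenPrimitiveHodgeFailureSpreadsToCMFibre) : HodgeFailureSpreadsToCMFibre :=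
  hodgeFailureSpreadsToCMFibre_of_evenPrimitive_of_primitiveLiftToProduct_of_lefschetzOneOne hPL
    lefschetzOneOne_rational_holds h

/-- **`F_CM^prim ⟹ F_CM` (N102 → N1) modulo the displayed `(PL)` ALONE.** Credits nothing until `(PL)` is a theorem. [folklore] -/
theorem hodgeFailureSpreadsToCMFibre_of_primitive_of_primitiveLiftToProduct
    (hPL : PrimitiveLiftToProduct[]) (h : PrimitiveHodgeFailureSpreadsToCMFibre) : HodgeFailureSpreadsToCMFibre :=
  hodgeFailureSpreadsToCMFibre_of_primitive_of_primitiveLiftToProduct_of_lefschetzOneOne hPL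
    lefschetzOneOne_rational_holds h

/-- **`F_CM ⟺ F_CM^prim` (N1 ≡ N102) modulo the displayed `(PL)` ALONE.** [folklore] -/
theorem hodgeFailureSpreadsToCMFibre_iff_primitive_of_primitiveLiftToProduct (hPL : PrimitiveLiftToProduct[]) :
    HodgeFailureSpreadsToCMFibre ↔ PrimitiveHodgeFailureSpreadsToCMFibre :=
  hodgeFailureSpreadsToCMFibre_iff_primitive_of_primitiveLiftToProduct_of_lefschetzOneOne hPL lefschetzOneOne_rational_holds

/-- **`F_CM ⟺ F_CM^{prim,ev}` (N1 ≡ N103) modulo the displayed `(PL)` ALONE.** [folklore] -/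
theorem hodgeFailureSpreadsToCMFibre_iff_evenPrimitive_of_primitiveLiftToProduct (hPL : PrimitiveLiftToProduct[]) :
    HodgeFailureSpreadsToCMFibre ↔ EvenPrimitiveHodgeFailureSpreadsToCMFibre :=
  hodgeFailureSpreadsToCMFibre_iff_evenPrimitive_of_primitiveLiftToProduct_of_lefschetzOneOne hPL lefschetzOneOne_rational_holds

/-- **THE THREE ANCHORED FLOOR NODES ARE ONE STATEMENT MODULO `(PL)`** (census N1 ≡ N102 ≡ N103): `(F_CM ↔ F_CM^prim) ∧
(F_CM^prim ↔ F_CM^{prim,ev})`, from parts XIV/XV's fact-free downward edges and this file's upward edges, with Lefschetz (1,1) supplied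
by name (`lefschetzOneOne_rational_holds`). Modulo the displayed `(PL)` — NOT a tree theorem, print argument in the header; the row credits nothing until `(PL)` is
proved. B_min of record UNCHANGED (least typed node `F_CM^{prim,ev}`); "minimal" and "strictly smaller than `F_CM`" claimed for nothing.
[cite: Andre1996Motifs, §1.3 (p. 12)] [cite: VoisinHodgeI2002, §6.2.3 Def. 6.24 and Cor. 6.26] -/
theorem spreadFloor_nodes_collapse_of_primitiveLiftToProduct (hPL : PrimitiveLiftToProduct[]) :
    (HodgeFailureSpreadsToCMFibre ↔ PrimitiveHodgeFailureSpreadsToCMFibre) ∧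
      (PrimitiveHodgeFailureSpreadsToCMFibre ↔ EvenPrimitiveHodgeFailureSpreadsToCMFibre) :=
  ⟨hodgeFailureSpreadsToCMFibre_iff_primitive_of_primitiveLiftToProduct hPL,
    primitiveHodgeFailureSpreadsToCMFibre_iff_evenPrimitive_of_primitiveLiftToProduct hPL⟩

end Summit.HodgeConjecture.HodgeConjecture.Ring2.AbelianAll
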